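import Mathlib
import Summits.QuantumFields.BalabanUV.Beta.AnalyticWalkSum216RowRegroup
import Summits.QuantumFields.BalabanUV.Beta.AnalyticWalkSum216RowPerturbation

/-!
# [Balaban1988RG2Cluster] (1.6)–(1.8) p. 3 ∕ [Balaban1985BackgroundPropagators] (3.107)–(3.108) p. 416 — THE REGROUPING
# GLUE, PART 2: every family the row-D4 chain builds DOMINATES its extremal decoration weight — the co-owner's fully
# decorated ω-expansion (`UnitLatticeOmegaRowData.decFamilyΩ`: `e^{κ₁#decΩ(w)}·‖walkTermΩ_w‖ ≤ decMajΩ_w`, by their tube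
# count) and the Neumann orders of the perturbative layer (`piTerm`∕`neuTerm`: induction on the order) — so the outputs of
# ALL three layers regroup into the next layer's finite (T3)-slot input by `AnalyticWalkSum216RowRegroup.regroup_bound`
# (cell topic `Summits/QuantumFields/BalabanUV/Beta`; row-D4 NODE A)

HONEST FRAMING (cell rule).  Discharging `BetaPertH` makes Bałaban's UV stability UNCONDITIONAL — a real constructive-QFT
result; NOT the continuum limit, NOT the Clay problem.  This module discharges NOTHING of `BetaPertH`.  [folklore]
bookkeeping closing the «NOT CLAIMED» items of `AnalyticWalkSum216RowRegroup` (gen 38, p218827): the domination hypothesis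
of `regroup_bound` for (a) the co-owner's `decFamilyΩ` (unit `b2b-balaban-beta-d4-p3` gen 4: the proof IS their
`rowData_decFamilyΩ.hm` argument with the CONSTANT coefficient `e^{κ₁#decΩ}` in place of the monomial — `card_decΩ_le` +
`norm_coeff_mul_walkTermΩ_le` BY NAME) and (b) ordered products ∕ the Neumann family of `AnalyticWalkSum216Neumann` (so the
output of `AnalyticWalkSum216RowPerturbation.pertTerm` regroups too).  After this file the statement «the six gen-38
modules compose G̃₀ → G₂ → G̃₂ → G̃₃(x) in ONE currency» has no prose residue: layer outputs (recombined ∕ sandwiched ∕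
Neumann ∕ ω-decorated families) are `Dominates`-certified by the constructors here and in the sibling, hence regroup
(`regroup_bound`) into the next layer's `rowData_decPieces` input with the same constant.  Nothing of Bałaban's operators
is instantiated; NO class change on any GAPS row; readiness width 0 unchanged; NOT summit progress.  Unit
`b2b-balaban-beta-an4-g38` (drafted) ∕ `-g39` (filed) — owner lineage of `BINDER-OWNERS.md` row D4; `GAPS.md` C-an4-100.

CITATION HEADER (lean-in-tree rule).  [II] = T. Bałaban, *Renormalization group approach to lattice gauge field theories.
II. Cluster expansions*, Commun. Math. Phys. **116**, 1–22 (1988) [Balaban1988RG2Cluster], p. 3 (1.6)–(1.8); [13] =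
T. Bałaban, *Propagators for lattice gauge theories in a background field*, Commun. Math. Phys. **99**, 389–434 (1985)
[Balaban1985BackgroundPropagators], Thm 3.10 (3.107)–(3.108) p. 416.  LOCATORS only (quoted in the siblings' headers);
nothing printed is asserted.

WHAT IS CERTIFIED HERE (kernel, sorry-free; [folklore]).
§1 **`dominates_decFamilyΩ`** — under the co-owner's GEOMETRIC binders (symmetric pseudo-metric, block-local pieces with
   threads∕credits, partition supports of diameter `≤ D`, cells with packing `Pk` at radius `Rr ≥ r + D, r + Df`,
   `κ₁ ≥ 0`): `Dominates κ₁ (decΩ …) (walkTermΩ …) (decMajΩ (e^{κ₁Pk}) (κ₁Pk/r) …)`.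
§2 `piA`∕`piS` (undecorated ordered products and their dependence sets), **`Dominates.pi`** (induction on the order via
   `Dominates.prod`), **`Dominates.neu`** (the Neumann index `Σ k, Fin k → W`), **`dominates_pert`** (the undecorated
   skeleton of `pertTerm TG₀ TW` is dominated by `pertMaj`).
§3 Non-vacuity.
NOT CLAIMED.  Any instance; that the chain's DECORATED families equal [II]'s `H(s)` beyond «same value at s ≡ 1, same
zero pattern, same majorant shape».  NOT summit progress.
PRIOR ART IN THE TREE (searched 2026-08-20): `AnalyticWalkSum216RowRegroup` (the glue and the finite-family constructors);
d4-p3's `UnitLatticeOmegaTube.card_decΩ_le`, `UnitLatticeOmegaPaths.norm_coeff_mul_walkTermΩ_le` (USED BY NAME);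
`AnalyticWalkSum216Neumann` (`piTerm`, `piMaj`, `neuTerm`, `neuMaj`).
-/

namespace Summit.QuantumFields.BalabanUV.Beta.AnalyticWalkSum216RowRegroupOmega

open Metric Set
open Literature.MathematicalPhysics.QuantumFieldTheory.Balaban1983to89
open B13PerturbativeStep (WRS WeightHyp wrs)
open Summit.QuantumFields.BalabanUV.Beta.AnalyticWalkSum216 (termSum majSum)
open Summit.QuantumFields.BalabanUV.Beta.AnalyticWalkSum216Algebra (prodMaj)
open Summit.QuantumFields.BalabanUV.Beta.AnalyticWalkSum216Neumann (piTerm piMaj neuTerm neuMaj)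
open Summit.QuantumFields.BalabanUV.Beta.AnalyticWalkSum216RowPerturbation (negTerm negMaj pertTerm pertMaj)
open Summit.QuantumFields.BalabanUV.Beta.AnalyticWalkSum216RowRegroup (Dominates)
open Summit.QuantumFields.BalabanUV.Beta.UnitLatticeTubeCount (pathLen pathLen_nonneg)
open Summit.QuantumFields.BalabanUV.Beta.UnitLatticeOmegaTerms
open Summit.QuantumFields.BalabanUV.Beta.UnitLatticeOmegaTube (listLen listLen_nonneg decΩ crSum crSum_nonneg card_decΩ_le)
open Summit.QuantumFields.BalabanUV.Beta.UnitLatticeOmegaPaths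
open Summit.QuantumFields.BalabanUV.Beta.UnitLatticeOmegaRowData (WalkΩ decMajΩ)

noncomputable section

variable {Y : Type*} [Fintype Y] [DecidableEq Y] {W Δ : Type*} [DecidableEq Δ]

/-! ## §1 The co-owner's fully decorated ω-family dominates its extremal decoration weight -/

section Omega

variable {B Ω : Type*} [DecidableEq Ω] {d : Y → Y → ℝ}

/-- **`e^{κ₁·#decΩ(w)}·‖walkTermΩ_w(i,j)‖ ≤ decMajΩ (e^{κ₁Pk}) (κ₁Pk/r) … w (i,j)`** — the co-owner's `rowData_decFamilyΩ.hm`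
argument with the constant coefficient `e^{κ₁#decΩ}`: by their tube count `#decΩ ≤ Pk·(1 + (pathLen(y) + crSum)/r)` for
every admissible chain `y` and their chain-credit bound `norm_coeff_mul_walkTermΩ_le`. [cite: Balaban1985BackgroundPropagators, Thm 3.10 (3.108) p.416] -/
theorem dominates_decFamilyΩ (htri : ∀ a b c, d a c ≤ d a b + d b c) (hzero : ∀ a, d a a = 0)
    (hnn : ∀ a b, 0 ≤ d a b) (hsymm : ∀ a b, d a b = d b a) (K : Ω → Matrix Y Y ℂ) (Dω : Ω → Finset Y)
    (hK : ∀ ω k l, K ω k l ≠ 0 → k ∈ Dω ω) (near : B → Finset Ω) (h : B → Y → ℝ) (E : B → Finset Y)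
    (L : B → Matrix Y Y ℂ) (hsupp : ∀ b y, y ∉ E b → h b y = 0) {κ₁ r D Df Rr : ℝ} (hκ₁ : 0 ≤ κ₁) (hr : 0 < r)
    (hRD : r + D ≤ Rr) (hRf : r + Df ≤ Rr) (cellOf : Y → Δ) {Pk : ℕ}
    (hpack : ∀ a : Y, ∃ S : Finset Δ, S.card ≤ Pk ∧ ∀ z, d a z ≤ Rr → cellOf z ∈ S)
    (hdiam : ∀ b, ∀ z ∈ E b, ∀ z' ∈ E b, d z z' ≤ D) (thr : Ω → List Y)
    (hthr : ∀ ω, ∀ z ∈ Dω ω, ∃ p ∈ thr ω, d z p ≤ Df) (cr : Ω → ℝ) (hcr : ∀ ω, 3 * listLen d (thr ω) + 2 * Df ≤ cr ω) :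
    Dominates κ₁ (fun w : WalkΩ B Ω => decΩ cellOf E Dω w.1 w.2.1 w.2.2)
      (fun w => walkTermΩ h K near L w.1 w.2.1 w.2.2)
      (decMajΩ (Real.exp (κ₁ * Pk)) (κ₁ * (Pk / r)) d cr h K near L) := by
  intro w i j
  have hδ : 0 ≤ κ₁ * (Pk / r) := mul_nonneg hκ₁ (div_nonneg (Nat.cast_nonneg Pk) hr.le)
  have hco : ‖((Real.exp (κ₁ * (decΩ cellOf E Dω w.1 w.2.1 w.2.2).card) : ℝ) : ℂ)‖ =
      Real.exp (κ₁ * (decΩ cellOf E Dω w.1 w.2.1 w.2.2).card) := by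
    rw [Complex.norm_real, Real.norm_of_nonneg (Real.exp_pos _).le]
  have h1 := norm_coeff_mul_walkTermΩ_le h E hsupp K Dω hK near L hδ d hnn htri cr (Real.exp_pos (κ₁ * Pk)).le
    w.1 w.2.1 w.2.2 ((Real.exp (κ₁ * (decΩ cellOf E Dω w.1 w.2.1 w.2.2).card) : ℝ) : ℂ) (fun y hy => ?_) i j
  · rw [hco] at h1
    rw [decMajΩ]
    exact h1
  · rw [hco, ← Real.exp_add]
    refine Real.exp_le_exp.2 ?_
    have hcnt := card_decΩ_le d htri hzero hnn hsymm hr hRD hRf cellOf hpack E hdiam Dω thr hthr cr hcr w.2.1 w.2.2 y hy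
    have := mul_le_mul_of_nonneg_left hcnt hκ₁
    calc κ₁ * ((decΩ cellOf E Dω w.1 w.2.1 w.2.2).card : ℝ)
        ≤ κ₁ * (Pk * (1 + (pathLen d w.1 y + crSum cr w.1 w.2.2) / r)) := this
      _ = κ₁ * Pk + κ₁ * (Pk / r) * (pathLen d w.1 y + crSum cr w.1 w.2.2) := by ring

end Omega

/-! ## §2 Ordered products and the Neumann family -/

section Pi

open Summit.QuantumFields.BalabanUV.Beta.AnalyticWalkSum216Neumann (split)

variable {κ₁ : ℝ} {S : W → Finset Δ} {A : W → Matrix Y Y ℂ} {m : W → Y → Y → ℝ}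

/-- The UNDECORATED ordered product of order `k` (= `piTerm` of the constant family, read at any parameter). [folklore] -/
def piA (A : W → Matrix Y Y ℂ) (k : ℕ) (l : Fin k → W) : Matrix Y Y ℂ := piTerm (fun w (_ : ℂ) => A w) k l 0

/-- Its dependence set: the union of the factors' sets (recursion along the siblings' `split`). [folklore] -/
def piS (S : W → Finset Δ) : (k : ℕ) → (Fin k → W) → Finset Δ
  | 0 => fun _ => ∅
  | k + 1 => fun l => S (split W k l).1 ∪ piS S k (split W k l).2

omit [DecidableEq Δ] in
/-- Recursion of `piA` along `split`. [folklore] -/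
theorem piA_succ (A : W → Matrix Y Y ℂ) (k : ℕ) (l : Fin (k + 1) → W) :
    piA A (k + 1) l = A (split W k l).1 * piA A k (split W k l).2 := by
  simp only [piA, AnalyticWalkSum216Neumann.piTerm_succ, AnalyticWalkSum216Algebra.prodTerm_apply]

omit [DecidableEq Y] in
/-- Recursion of `piS`. [folklore] -/
theorem piS_succ (S : W → Finset Δ) (k : ℕ) (l : Fin (k + 1) → W) :
    piS S (k + 1) l = S (split W k l).1 ∪ piS S k (split W k l).2 := rfl

/-- **Ordered products of dominated factors are dominated** (by `piMaj`, dependence set `piS`), for `κ₁ ≥ 0` — induction on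
the order with `Dominates.prod`. [folklore] -/
theorem Dominates.pi (hκ₁ : 0 ≤ κ₁) (h : Dominates κ₁ S A m) :
    ∀ k, Dominates κ₁ (piS S k) (piA A k) (piMaj m k)
  | 0 => fun l i j => by
    show Real.exp (κ₁ * ((∅ : Finset Δ).card : ℕ)) * ‖(1 : Matrix Y Y ℂ) i j‖ ≤ (1 : Matrix Y Y ℝ) i j
    rw [Finset.card_empty, Nat.cast_zero, mul_zero, Real.exp_zero, one_mul]
    by_cases hij : i = j
    · subst hij; simp
    · simp [Matrix.one_apply_ne hij]
  | k + 1 => fun l i j => by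
    have hp := (h.prod hκ₁ (Dominates.pi hκ₁ h k)) (split W k l) i j
    dsimp only at hp
    rw [piS_succ, piA_succ, AnalyticWalkSum216Neumann.piMaj_succ]
    exact hp

/-- **The Neumann family** (index `Σ k, Fin k → W`) is dominated by `neuMaj`. [folklore] -/
theorem Dominates.neu (hκ₁ : 0 ≤ κ₁) (h : Dominates κ₁ S A m) :
    Dominates κ₁ (fun x : Σ k, Fin k → W => piS S x.1 x.2) (fun x => piA A x.1 x.2) (neuMaj m) :=
  fun x i j => Dominates.pi hκ₁ h x.1 x.2 i j

/-- **The undecorated skeleton of the perturbative layer** `A_G₀(w)·Π_t(−A_W(l t))` with dependence set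
`S_G₀(w) ∪ ⋃_t S_W(l t)` is dominated by `pertMaj mG₀ mW = prodMaj mG₀ (neuMaj (negMaj mW))` (`prod` ∘ `neu` ∘
`smul (‖−1‖ ≤ 1)`; `pertMaj_eq`). [folklore] -/
theorem dominates_pert {V : Type*} (hκ₁ : 0 ≤ κ₁) {SG : W → Finset Δ} {AG : W → Matrix Y Y ℂ}
    {mG : W → Y → Y → ℝ} (hG : Dominates κ₁ SG AG mG) {SW : V → Finset Δ} {AW : V → Matrix Y Y ℂ}
    {mW : V → Y → Y → ℝ} (hW : Dominates κ₁ SW AW mW) :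
    Dominates κ₁ (fun p : W × (Σ k, Fin k → V) => SG p.1 ∪ piS SW p.2.1 p.2.2)
      (fun p => AG p.1 * piA (fun v => (-1 : ℂ) • AW v) p.2.1 p.2.2) (pertMaj mG mW) := by
  have hN : Dominates κ₁ SW (fun v => (-1 : ℂ) • AW v) (negMaj mW) :=
    hW.smul (c := (-1 : ℂ)) (X := 1) (by rw [norm_neg, norm_one])
  have hNe := Dominates.neu hκ₁ hN
  have h3 := Dominates.prod hκ₁ hG hNe
  exact h3

omit [DecidableEq Δ] in
/-- … and `prodMaj mG (neuMaj (negMaj mW))` IS the perturbative layer's majorant `pertMaj mG mW`. [folklore] -/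
theorem pertMaj_eq {V : Type*} (mG : W → Y → Y → ℝ) (mW : V → Y → Y → ℝ) :
    pertMaj mG mW = prodMaj mG (neuMaj (negMaj mW)) := rfl

end Pi

/-! ## §3 Non-vacuity -/

/-- `Dominates.pi` on concrete data: one site, one cell, the single factor `A = 1` with dependence set `{()}`, `κ₁ = 0`,
majorant `1`; at order `2` the bound reads `1·‖1‖ ≤ Σ_c 1·(Σ_c′ 1·1)`. [folklore] -/
example : Dominates (0 : ℝ) (piS (fun _ : Unit => ({()} : Finset Unit)) 2)
    (piA (fun _ : Unit => (1 : Matrix Unit Unit ℂ)) 2) (piMaj (fun _ _ _ => (1 : ℝ)) 2) :=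
  Dominates.pi le_rfl (fun _ i j => by simp) 2

end

end Summit.QuantumFields.BalabanUV.Beta.AnalyticWalkSum216RowRegroupOmega
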